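import Literature.NumberTheory.EllipticCurves.BSDRankZeroFamily
import HarnessLib

/-!
# The §4.1 subfamily of Bhargava–Shankar is non-empty; numerical evidence for the root-number fact

`Proofs` companion of `Literature/NumberTheory/EllipticCurves/BSDRankZeroFamily.lean` (the
root-number family of M. Bhargava, A. Shankar, *Ternary cubic forms having bounded invariants, and
the existence of a positive proportion of elliptic curves having rank 0*, Ann. of Math. (2) 181
(2015) 587–621 = arXiv:1007.0052v2, §4.1, in `(A, B)`-coordinates). Only theorems are added; no
definition and no statement of that file is changed.

* `isBSFamily_twenty`, `isBSFamily_neg_fortyfour`, `exists_isBSFamily`: the base points `(20, 176)`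
  (`4A³ + 27B² = 2¹⁴·53`) and `(-44, 48)` (`4A³ + 27B² = -2¹⁴·17`) are members of the two sign pieces
  `IsBSFamily true`, `IsBSFamily false`, so both pieces are non-empty (they even have positive
  proportion, `exists_pos_le_heightProportion_isBSFamily`); helper `oddSqfree_of_natAbs_negDisc_eq`.

## Numerical evidence for the named fact `rootNumber_negB_of_isBSFamily` (not a proof)

Recorded for refuters and reviewers of that fact (`ω(E_{A,-B}) = -ω(E_{A,B})` on the subfamily,
the source's sentence "`ω(E) = -ω(E₋₁)` for all `E ∈ F`" restricted to `v₂(A) = 2`). For each of the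
`96` members `(A, B)` with `|A| ≤ 8000`, `0 < B < 1.6·10⁵` and odd part `m = |4A³ + 27B²|/2¹⁴ ≤ 2·10⁴`
(all of them; `62` with `s = true`, `34` with `s = false`), the global root numbers of `E_{A,B}` and
`E_{A,-B}` were computed from the `L`-series alone: `a_p` by point counting at the good primes (the
model `y² = x³ + Ax + B` is minimal away from `2`), `a_p = ±1` at the odd primes `p ∣ m`
(multiplicative; split iff `864B` is a non-zero square mod `p`), `a_2 = 0` (additive), and the sign
`w` read off from the modular relation `F(1/t) = w·t²·F(t)` for `F(t) = ∑ₙ aₙ e^{-2πnt/√N}`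
(`t = 1.1, 1.3, 1.7`), the conductor `N = 2ᶠ·m` being determined by testing `f ∈ [2, 8]`: in every
case `f = 6`, with relative defect `≤ 2·10⁻¹³` for the selected pair `(N, w)` against `≥ 6·10⁻³` for
every other candidate. Result: `w(E_{A,B})·w(E_{A,-B}) = -1` in all `96` cases, as the fact asserts
(`w(E_{A,B}) = +1` for `50` of them, `-1` for `46`). The smallest members: `(A, B, m, N, w(E), w(E₋₁))`
`= (-44, 48, 17, 1088, +1, -1)`, `(20, 176, 53, 3392, +1, -1)`, `(-76, 144, 73, 4672, -1, +1)`,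
`(-524, 4624, 109, 6976, +1, -1)`, `(-172, 816, 145, 9280, -1, +1)`. (Pure-Python script
`compute/rootno.py` and tables `compute/EVIDENCE.md` in the session folder of the
`pos_proportion_rank_zero` fact seat, 2026-08-14.)

## References

* [BhargavaShankarTernary2015] M. Bhargava, A. Shankar, Ann. of Math. (2) 181 (2015) 587–621
  = arXiv:1007.0052v2, §4.1.
-/

open Literature.NumberTheory.EllipticCurves.RankZeroSieve

namespace Literature.NumberTheory.EllipticCurves

/-- If `|4A³ + 27B²| = 2ᵏ·q` with `q` an odd prime, then `4A³ + 27B²` is squarefree away from `2`.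
[folklore] -/
theorem oddSqfree_of_natAbs_negDisc_eq {AB : ℤ × ℤ} {k q : ℕ} (hq : q.Prime) (hq2 : q ≠ 2)
    (h : (negDisc AB).natAbs = 2 ^ k * q) : OddSqfree AB := by
  intro p hp hp2 hdvd
  have h1 : p ^ 2 ∣ (negDisc AB).natAbs := by
    have := Int.natAbs_dvd_natAbs.mpr hdvd
    simpa [Int.natAbs_pow] using this
  rw [h] at h1
  have hp1 : p ∣ 2 ^ k * q := dvd_trans (dvd_pow_self p two_ne_zero) h1
  rcases (Nat.Prime.dvd_mul hp).mp hp1 with h2 | h2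
  · exact hp2 ((Nat.prime_dvd_prime_iff_eq hp Nat.prime_two).mp (hp.dvd_of_dvd_pow h2))
  · have hpq : p = q := (Nat.prime_dvd_prime_iff_eq hp hq).mp h2
    subst hpq
    have h3 : p * p ∣ 2 ^ k * p := by simpa [pow_two] using h1
    have h4 : p ∣ 2 ^ k := (Nat.mul_dvd_mul_iff_right hp.pos).mp h3
    exact hp2 ((Nat.prime_dvd_prime_iff_eq hp Nat.prime_two).mp (hp.dvd_of_dvd_pow h4))

/-- The base point `(20, 176)` of the sign-`+` piece is a member of the §4.1 subfamily:
`20 ≡ 4 (mod 8)`, `4·20³ + 27·176² = 868352 = 2¹⁴·53 ≡ 2¹⁴ (mod 2¹⁶)` with `53` prime, and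
`868352 > 0`. (Its curve `y² = x³ + 20x + 176` has conductor `2⁶·53`; numerically `w = +1`, and
`w = -1` for `y² = x³ + 20x - 176`, see the module docstring.) [folklore] -/
theorem isBSFamily_twenty : IsBSFamily true (20, 176) := by
  refine ⟨by decide, ?_, ?_, ?_⟩
  · simp only [bsResidue, ↓reduceIte, negDisc_apply]
    decide
  · exact oddSqfree_of_natAbs_negDisc_eq (k := 14) (q := 53) (by norm_num) (by norm_num)
      (by rw [negDisc_apply]; rfl)
  · simp only [↓reduceIte, negDisc_apply]
    norm_num

/-- The base point `(-44, 48)` of the sign-`-` piece is a member of the §4.1 subfamily: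
`-44 ≡ 4 (mod 8)`, `4·(-44)³ + 27·48² = -278528 = -2¹⁴·17 ≡ -2¹⁴ (mod 2¹⁶)` with `17` prime, and
`-278528 < 0`. (Its curve `y² = x³ - 44x + 48` has conductor `2⁶·17`; numerically `w = +1`, and
`w = -1` for `y² = x³ - 44x - 48`.) [folklore] -/
theorem isBSFamily_neg_fortyfour : IsBSFamily false (-44, 48) := by
  refine ⟨by decide, ?_, ?_, ?_⟩
  · simp only [bsResidue, Bool.false_eq_true, ↓reduceIte, negDisc_apply]
    decide
  · exact oddSqfree_of_natAbs_negDisc_eq (k := 14) (q := 17) (by norm_num) (by norm_num)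
      (by rw [negDisc_apply]; rfl)
  · simp only [Bool.false_eq_true, ↓reduceIte, negDisc_apply]
    norm_num

/-- Both sign pieces of the §4.1 subfamily are non-empty (so the named fact
`rootNumber_negB_of_isBSFamily` and the largeness/positive-proportion theorems of
`BSDRankZeroFamily.lean` are not vacuous). [folklore] -/
theorem exists_isBSFamily (s : Bool) : ∃ AB : ℤ × ℤ, IsBSFamily s AB := by
  cases s
  · exact ⟨_, isBSFamily_neg_fortyfour⟩
  · exact ⟨_, isBSFamily_twenty⟩

end Literature.NumberTheory.EllipticCurves
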